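import Literature.NumberTheory.EllipticCurves.CongruentNumberEvenMonskySelmerKernelRelations
import Literature.NumberTheory.EllipticCurves.CongruentNumberMonskySelmerCandidates
import Literature.NumberTheory.EllipticCurves.CongruentNumberTwoDescentLocal
import HarnessLib

/-!
# Monsky's `2`-Selmer formula for `E_n`, `n = 2p₁⋯p_k`, `≥` half, II: every kernel vector of `M` is a Selmer class

Companion ("lower bound") of `CongruentNumberEvenMonskySelmer{Local,Bound}.lean`, which prove
`#Sel⁽²⁾(E_n/ℚ) ≤ 2^{2+s(n)}`, `2^{s(n)} = #ker M`, `M = ( Aᵀ + D₂  D₋₁ ; D₂  A + D₂ )` Monsky's matrix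
(appendix to Heath-Brown, Invent. Math. 118 (1994), even case, typescript p. 41: "one finds that `2^{s(D)}` is
the size of the kernel of the matrix `M`", printed as "a sketch proof"). There a normalised Selmer class was sent
to its coordinate vector `(v_{pᵢ}(b); v_{pᵢ}(a)) ∈ ker M`. HERE the converse: for every `x = (β; α) ∈ ker M` the
pair `(a, b) = (∏ pᵢ^{αᵢ}, ε ∏ pᵢ^{βᵢ})`, `ε = ±1` chosen with `b ≡ 1 (mod 4)` (`candB`), has its class
`c(a, b) = twoDescentClass (a, b)` IN `Sel⁽²⁾(E_n/ℚ)`, normalised, with coordinates `x`: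

* §1 (`…KernelRelations.lean`) FROM `Mx = 0`: the row relations `rel_inr`, `rel_inl` and the summed relations
  `Σ uⱼαⱼ = Σ wⱼβⱼ`, `Σ wⱼαⱼ = (Σ uⱼ)·(Σ wⱼβⱼ)` — the `2`-adic conditions;
* §2 the signed second coordinate `candB` and its local data;
* §3 **`twoDescentClass_kernel_mem_selmerGroup`**: `c(a, b) ∈ Sel⁽²⁾(E_n/ℚ)` for every `x ∈ ker M`
  (local solubility everywhere: `CongruentNumberTwoDescentLocal.lean` at the `pᵢ`, at `2` — the point `O` when
  `Σ wⱼβⱼ = 0`, the `2`-adic point `(5, √(125 − 5n²))` when `Σ wⱼβⱼ = 1` —, at `∞` and at the good primes),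
  with `v₂(b) = 0`, `χ₄(b) = 0`, `v_{pᵢ}(a) = αᵢ`, `v_{pᵢ}(b) = βᵢ`.

The count `#Sel⁽²⁾ = 2^{2+s}` is assembled in `CongruentNumberEvenMonskySelmerExact.lean`. Theorems and one
definition with body; no named fact. Cell `bsd-monsky` (prover-B).

## References

* [HeathBrown1994SelmerCongruentII] D. R. Heath-Brown, Invent. Math. 118 (1994) 331–370, Appendix
  (P. Monsky): typescript p. 38 L24–L31, p. 39 L1–L41 (`A`, `D_j`, `A + Aᵀ = D₋₁ + uᵀu`, `c(A) = 0`,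
  `r(A) = u` or `0`), p. 41 L1–L36 (even `D`).
* [SilvermanAEC2009] J. H. Silverman, *The Arithmetic of Elliptic Curves*, 2nd ed., Prop. X.1.4, X.4.9.
-/

noncomputable section

open scoped Classical

open WeierstrassCurve
open Literature.NumberTheory.GaloisRepresentations
open Literature.NumberTheory.EllipticCurves.KramerTwoDescent
open Literature.NumberTheory.EllipticCurves.TwoDescentLocal
open Literature.NumberTheory.EllipticCurves.HeathBrown1994
open Literature.NumberTheory.EllipticCurves.CongruentNumberEvenMonskySelmer
open Literature.NumberTheory.EllipticCurves.MonskySelmerCandidates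
open Literature.NumberTheory.EllipticCurves.CongruentNumberTwoDescent
open IsDedekindDomain NumberField Rat.HeightOneSpectrum Matrix

namespace Literature.NumberTheory.EllipticCurves

namespace CongruentNumberEvenMonskySelmerKernel

variable {k : ℕ} {p : Fin k → ℕ}

/-! ## §0 Bookkeeping in `ℤ/2` -/

/-- The two values of a bit. [folklore] -/
private theorem zmod2_cases (x : ZMod 2) : x = 0 ∨ x = 1 := by revert x; decide

/-- `chi8` of an odd integer through its class mod `8` (cast form of `chi8_intCast`). [folklore] -/
private theorem chi8_intCast' {z : ℤ} (hz : ¬ (2 : ℤ) ∣ z) : chi8 (z : ℚ) = chi8Of (z : ZMod (2 ^ 3)) := by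
  rw [chi8, res8_intCast hz]

/-- The residues `5 + 2d (mod 8)` against `d (mod 8)`: `χ₄(5+2d) = 1`, `χ₈(5+2d) = χ₄(d)` (closed checks). [folklore] -/
private theorem chi48_table :
    (chi4Of ((7 : ℤ) : ZMod (2 ^ 3)) = 1 ∧ chi8Of ((7 : ℤ) : ZMod (2 ^ 3)) = chi4Of ((1 : ℤ) : ZMod (2 ^ 3))) ∧
    (chi4Of ((3 : ℤ) : ZMod (2 ^ 3)) = 1 ∧ chi8Of ((3 : ℤ) : ZMod (2 ^ 3)) = chi4Of ((3 : ℤ) : ZMod (2 ^ 3))) ∧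
    (chi4Of ((7 : ℤ) : ZMod (2 ^ 3)) = 1 ∧ chi8Of ((7 : ℤ) : ZMod (2 ^ 3)) = chi4Of ((5 : ℤ) : ZMod (2 ^ 3))) ∧
    (chi4Of ((3 : ℤ) : ZMod (2 ^ 3)) = 1 ∧ chi8Of ((3 : ℤ) : ZMod (2 ^ 3)) = chi4Of ((7 : ℤ) : ZMod (2 ^ 3))) := by
  decide

/-! ## §2 The signed second coordinate `b = ε ∏ pᵢ^{βᵢ}`, `b ≡ 1 (mod 4)` -/

variable (p) in
/-- **The second coordinate of the candidate pair**: `candB p β = ± ∏_{βᵢ = 1} pᵢ` with the sign chosen so that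
`χ₄ = 0` (`b ≡ 1 (mod 4)` up to its `2`-adic unit: Monsky's normalisation "`a ≡ 1 (mod 4)`" of the first
printed coordinate, which is the tree's `b`). [cite: HeathBrown1994SelmerCongruentII, Appendix (Monsky), typescript p. 41 L1–L5] -/
def candB (β : Fin k → ZMod 2) : ℤ :=
  if (∑ j, addLegendreSym (-1) (p j) * β j) = 0 then (bitProd p β : ℤ) else -(bitProd p β : ℤ)

/-- `candB` is `± bitProd`. [cite: HeathBrown1994SelmerCongruentII, Appendix (Monsky), typescript p. 41 L1–L5] -/
theorem cast_candB (β : Fin k → ZMod 2) :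
    ((candB p β : ℤ) : ℚ) = (bitProd p β : ℚ) ∨ ((candB p β : ℤ) : ℚ) = -(bitProd p β : ℚ) := by
  unfold candB; split_ifs <;> simp

/-- `candB ≠ 0`. [cite: HeathBrown1994SelmerCongruentII, Appendix (Monsky), typescript p. 41 L1–L5] -/
theorem cast_candB_ne_zero (hp : ∀ i, (p i).Prime) (β : Fin k → ZMod 2) : ((candB p β : ℤ) : ℚ) ≠ 0 := by
  rcases cast_candB β with h | h <;> rw [h]
  · exact cast_bitProd_ne_zero hp β
  · exact neg_ne_zero.mpr (cast_bitProd_ne_zero hp β)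

/-- `v_r(candB) = v_r(bitProd)` at every prime. [cite: HeathBrown1994SelmerCongruentII, Appendix (Monsky), typescript p. 41 L1–L5] -/
theorem padicValRat_candB (r : ℕ) (β : Fin k → ZMod 2) :
    padicValRat r ((candB p β : ℤ) : ℚ) = padicValRat r (bitProd p β : ℚ) := by
  rcases cast_candB (p := p) β with h | h <;> rw [h]
  rw [padicValRat.neg]

/-- `parityBit pᵢ (candB) = βᵢ`. [cite: HeathBrown1994SelmerCongruentII, Appendix (Monsky), typescript p. 41 L1–L5] -/
theorem parityBit_candB (hp : ∀ i, (p i).Prime) (hinj : Function.Injective p) (β : Fin k → ZMod 2) (i : Fin k) :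
    parityBit (p i) ((candB p β : ℤ) : ℚ) = β i := by
  unfold parityBit
  rw [padicValRat_candB]
  exact parityBit_bitProd hp hinj β i

/-- **`χ₄(candB) = 0`** (the normalisation). [cite: HeathBrown1994SelmerCongruentII, Appendix (Monsky), typescript p. 41 L1–L5] -/
theorem chi4_candB (hp : ∀ i, (p i).Prime) (hp2 : ∀ i, p i ≠ 2) (hinj : Function.Injective p)
    (β : Fin k → ZMod 2) : chi4 ((candB p β : ℤ) : ℚ) = 0 := by
  unfold candB
  split_ifs with h
  · push_cast; rw [chi4_bitProd hp hp2 hinj, h]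
  · push_cast
    rw [chi4_neg_bitProd hp hp2 hinj]
    rcases zmod2_cases (∑ j, addLegendreSym (-1) (p j) * β j) with h0 | h1
    · exact absurd h0 h
    · rw [h1]; decide

/-- `χ₈(candB) = Σ wⱼ βⱼ`. [cite: HeathBrown1994SelmerCongruentII, Appendix (Monsky), typescript p. 41 L1–L19] -/
theorem chi8_candB (hp : ∀ i, (p i).Prime) (hp2 : ∀ i, p i ≠ 2) (β : Fin k → ZMod 2) :
    chi8 ((candB p β : ℤ) : ℚ) = ∑ j, addLegendreSym 2 (p j) * β j := by
  rcases cast_candB (p := p) β with h | h <;> rw [h]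
  · exact chi8_bitProd hp hp2 β
  · exact chi8_neg_bitProd hp hp2 β

/-- **`qr_{pᵢ}(candB) = S·uᵢ + Σ_{j≠i} A_ij βⱼ`**, `S = Σ uⱼβⱼ` (the sign contributes `S·[−1]ᵢ`).
[cite: HeathBrown1994SelmerCongruentII, Appendix (Monsky), typescript p. 41 L1–L19] -/
theorem qrBit_candB (hp : ∀ i, (p i).Prime) (hp2 : ∀ i, p i ≠ 2) (hinj : Function.Injective p)
    (β : Fin k → ZMod 2) (i : Fin k) :
    haveI : Fact (p i).Prime := ⟨hp i⟩
    qrBit (p i) ((candB p β : ℤ) : ℚ) =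
      (∑ j, addLegendreSym (-1) (p j) * β j) * addLegendreSym (-1) (p i) +
        ∑ j ∈ Finset.univ.erase i, addLegendreSym (p j) (p i) * β j := by
  haveI : Fact (p i).Prime := ⟨hp i⟩
  unfold candB
  split_ifs with h
  · push_cast; rw [qrBit_bitProd hp hp2 hinj, h, zero_mul, zero_add]
  · push_cast
    rw [qrBit_neg_bitProd hp hp2 hinj]
    rcases zmod2_cases (∑ j, addLegendreSym (-1) (p j) * β j) with h0 | h1
    · exact absurd h0 h
    · rw [h1, one_mul]

/-- A prime dividing `candB` is one of the `pᵢ`. [cite: HeathBrown1994SelmerCongruentII, Appendix (Monsky), typescript p. 39 L4–L9] -/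
theorem exists_eq_of_prime_dvd_candB (hp : ∀ i, (p i).Prime) (β : Fin k → ZMod 2) {r : ℕ} (hr : r.Prime)
    (hdvd : (r : ℤ) ∣ candB p β) : ∃ i, p i = r := by
  have h' : (r : ℤ) ∣ (bitProd p β : ℤ) := by
    unfold candB at hdvd; split_ifs at hdvd
    · exact hdvd
    · exact (dvd_neg.mp hdvd)
  obtain ⟨i, -, hi⟩ := exists_eq_of_prime_dvd_bitProd hp β hr (by exact_mod_cast h')
  exact ⟨i, hi⟩

/-! ## §3 The class of a kernel vector is a Selmer class -/

section Selmer

variable (hp : ∀ i, (p i).Prime) (hp2 : ∀ i, p i ≠ 2) (hinj : Function.Injective p)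
variable [hE : (congruentNumberCurve (2 * ∏ i, p i)).IsElliptic]

omit hE in
include hp in
/-- `2 ∏ pᵢ ≠ 0`. [folklore] -/
private theorem n_ne_zero : 2 * ∏ i, p i ≠ 0 :=
  mul_ne_zero two_ne_zero (Finset.prod_ne_zero_iff.mpr fun i _ => (hp i).ne_zero)

omit hE in
include hp hp2 in
/-- `n = 2 ∏ pᵢ ≡ 2 (mod 4)`. [folklore] -/
private theorem n_mod_four : (2 * ∏ i, p i) % 4 = 2 := by
  have hodd : Odd (∏ i, p i) :=
    Finset.prod_induction _ Odd (fun _ _ ha hb => ha.mul hb) odd_one fun i _ => (hp i).odd_of_ne_two (hp2 i)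
  obtain ⟨m, hm⟩ := hodd
  omega

omit hE in
include hp hp2 hinj in
/-- `v_{pᵢ}(n) = 1` for `n = 2 ∏ pⱼ`. [folklore] -/
private theorem padicValRat_n (i : Fin k) :
    haveI : Fact (p i).Prime := ⟨hp i⟩
    padicValRat (p i) ((2 * ∏ j, p j : ℕ) : ℚ) = 1 := by
  haveI : Fact (p i).Prime := ⟨hp i⟩
  haveI : Fact (Nat.Prime 2) := ⟨Nat.prime_two⟩
  have hprod : (∏ j, (p j : ℚ)) = (bitProd p (fun _ => 1) : ℚ) := by
    rw [cast_bitProd]; simp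
  rw [show ((2 * ∏ j, p j : ℕ) : ℚ) = 2 * ∏ j, (p j : ℚ) by push_cast; ring,
    padicValRat.mul two_ne_zero (Finset.prod_ne_zero_iff.mpr fun j _ => Nat.cast_ne_zero.mpr (hp j).ne_zero),
    show (2 : ℚ) = ((2 : ℕ) : ℚ) from rfl, padicValRat.of_nat, padicValNat_primes (hp2 i), hprod,
    padicValRat_bitProd_self hp hinj _ i]
  simp

include hp hp2 hinj in
/-- **Every kernel vector of Monsky's matrix gives a Selmer class.** For `x = (β; α)` with `M x = 0`, the class
`c(a, b)` of the pair `a = ∏ pᵢ^{αᵢ}`, `b = candB β = ± ∏ pᵢ^{βᵢ}` lies in `Sel⁽²⁾(E_n/ℚ)`, `n = 2p₁⋯p_k`: it is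
everywhere locally a descent pair — at each `pᵢ` by the row relations (`rel_inr`, `rel_inl`), at `2` by the
summed relations (`Σuα = Σwβ`, `Σwα = |u|·Σwβ`: the pair is `2`-adically `(1, 1)` or `([5 + n], [5])`), at `∞`
since `a > 0`, and at the good primes since `a, b` are units there.
[cite: HeathBrown1994SelmerCongruentII, Appendix (Monsky), typescript p. 41 L1–L36]
[cite: SilvermanAEC2009, Prop. X.1.4, Prop. X.4.9] -/
theorem twoDescentClass_kernel_mem_selmerGroup {β α : Fin k → ZMod 2}
    (hx : monskyMatrixEven p *ᵥ Sum.elim β α = 0) :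
    (congruentNumberCurve (2 * ∏ i, p i)).twoDescentClass (splitTwoTorsion_cn (2 * ∏ i, p i))
        (Units.mk0 (bitProd p α : ℚ) (cast_bitProd_ne_zero hp α))
        (Units.mk0 ((candB p β : ℤ) : ℚ) (cast_candB_ne_zero hp β)) ∈
      (congruentNumberCurve (2 * ∏ i, p i)).selmerGroup 2 := by
  haveI : Fact (Nat.Prime 2) := ⟨Nat.prime_two⟩
  have hU := sum_u_alpha_eq hx
  have hW := sum_w_alpha_eq hp hp2 hinj hx
  refine twoDescentClass_mem_selmerGroup_of_local (n_ne_zero hp) _ _ (bitProd p α : ℤ) (candB p β)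
    (by push_cast; rfl) rfl (by rw [Units.val_mk0]; exact_mod_cast bitProd_pos hp α) ?_ ?_ ?_
  · -- good odd primes
    intro ℓ hℓ _ hℓn
    constructor
    · intro h
      obtain ⟨i, -, hi⟩ := exists_eq_of_prime_dvd_bitProd hp α hℓ (by exact_mod_cast h)
      exact hℓn (hi ▸ dvd_mul_of_dvd_right (Finset.dvd_prod_of_mem p (Finset.mem_univ i)) 2)
    · intro h
      obtain ⟨i, hi⟩ := exists_eq_of_prime_dvd_candB hp β hℓ h
      exact hℓn (hi ▸ dvd_mul_of_dvd_right (Finset.dvd_prod_of_mem p (Finset.mem_univ i)) 2)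
  · -- the odd primes `ℓ ∣ n`: `ℓ = p i`
    intro ℓ hℓ hℓ2 hℓn
    have hℓ' : ℓ ∣ ∏ i, p i := by
      rcases (Nat.Prime.dvd_mul hℓ).mp hℓn with h | h
      · exact absurd ((Nat.prime_dvd_prime_iff_eq hℓ Nat.prime_two).mp h) hℓ2
      · exact h
    obtain ⟨i, -, hi⟩ := (Prime.dvd_finsetProd_iff hℓ.prime _).mp hℓ'
    have hℓi : p i = ℓ := ((Nat.prime_dvd_prime_iff_eq hℓ (hp i)).mp hi).symm
    subst hℓi
    haveI : Fact (p i).Prime := ⟨hp i⟩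
    refine ⟨padicValRat_n hp hp2 hinj i, ?_, ?_⟩
    · rw [Units.val_mk0, Units.val_mk0, qrBit_bitProd hp hp2 hinj, parityBit_bitProd hp hinj,
        parityBit_candB hp hinj, qrBit_n hp hp2 hinj i, qrBit_two_eq_addLegendreSym (hp2 i), rel_inr hx i]
    · rw [Units.val_mk0, Units.val_mk0, qrBit_candB hp hp2 hinj, parityBit_bitProd hp hinj,
        parityBit_candB hp hinj, qrBit_n hp hp2 hinj i, qrBit_neg_one_eq_addLegendreSym, rel_inl hp hp2 hinj hx i]
      ring
  · -- the prime `2`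
    intro v hv
    have hva : padicValRat 2 (bitProd p α : ℚ) = 0 := padicValRat_bitProd_of_forall_ne hp hinj α Nat.prime_two hp2
    have hvb : padicValRat 2 ((candB p β : ℤ) : ℚ) = 0 := by
      rw [padicValRat_candB]; exact padicValRat_bitProd_of_forall_ne hp hinj β Nat.prime_two hp2
    have h4a : chi4 (bitProd p α : ℚ) = ∑ j, addLegendreSym 2 (p j) * β j := by rw [chi4_bitProd hp hp2 hinj, hU]
    have h8a : chi8 (bitProd p α : ℚ) = (∑ j, addLegendreSym (-1) (p j)) * ∑ j, addLegendreSym 2 (p j) * β j := by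
      rw [chi8_bitProd hp hp2, hW]
    have h4b := chi4_candB hp hp2 hinj β
    have h8b := chi8_candB hp hp2 β
    rcases zmod2_cases (∑ j, addLegendreSym 2 (p j) * β j) with h0 | h1
    · -- `Σ wβ = 0`: the pair is `2`-adically `(1, 1)`
      rw [h0] at h4a h8a h8b
      rw [mul_zero] at h8a
      exact twoDescentClass_mem_selmerLocalKer_two_of_res8_eq_one v hv _ _ hva hvb
        (res8_eq_one_of_chi4_chi8 (cast_bitProd_ne_zero hp α) h4a h8a)
        (res8_eq_one_of_chi4_chi8 (cast_candB_ne_zero hp β) h4b h8b)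
    · -- `Σ wβ = 1`: the pair is `2`-adically `([5 + n], [5])`
      rw [h1] at h4a h8a h8b
      rw [mul_one] at h8a
      have hn0 : ((2 * ∏ i, p i : ℕ) : ℚ) ≠ 0 := by exact_mod_cast n_ne_zero hp
      have h5n0 : (5 : ℚ) + ((2 * ∏ i, p i : ℕ) : ℚ) ≠ 0 := by positivity
      -- `5 + n = 5 + 2d`, `d` odd: `χ₄ = 1`, `χ₈ = χ₄(d) = Σ uⱼ`
      have hd : chi4 (5 + ((2 * ∏ i, p i : ℕ) : ℚ)) = 1 ∧
          chi8 (5 + ((2 * ∏ i, p i : ℕ) : ℚ)) = ∑ j, addLegendreSym (-1) (p j) := by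
        have hU' : (∑ j, addLegendreSym (-1) (p j)) = chi4 (((∏ j, (p j : ℤ) : ℤ)) : ℚ) := (chi4_prod hp hp2).symm
        have hoddD : Odd (∏ j, (p j : ℤ)) :=
          Finset.prod_induction _ Odd (fun _ _ ha hb => ha.mul hb) odd_one
            fun i _ => (Int.odd_coe_nat _).mpr ((hp i).odd_of_ne_two (hp2 i))
        set d : ℤ := ∏ j, (p j : ℤ) with hddef
        have hodd : ¬ (2 : ℤ) ∣ d := by obtain ⟨m, hm⟩ := hoddD; omega
        have hcast : (5 : ℚ) + ((2 * ∏ i, p i : ℕ) : ℚ) = ((5 + 2 * d : ℤ) : ℚ) := by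
          rw [hddef]; push_cast; ring
        have hodd5 : ¬ (2 : ℤ) ∣ (5 + 2 * d) := by omega
        rw [hcast, hU', chi4_intCast hodd5, chi8_intCast' hodd5, chi4_intCast hodd]
        have hc1 : ((5 + 2 * d : ℤ) : ZMod (2 ^ 3)) = (((5 + 2 * d) % 8 : ℤ) : ZMod (2 ^ 3)) := by
          rw [show (2 : ℕ) ^ 3 = 8 from rfl]; exact (ZMod.intCast_mod _ 8).symm
        have hc2 : (d : ZMod (2 ^ 3)) = ((d % 8 : ℤ) : ZMod (2 ^ 3)) := by
          rw [show (2 : ℕ) ^ 3 = 8 from rfl]; exact (ZMod.intCast_mod _ 8).symm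
        rw [hc1, hc2]
        have h8 : d % 8 = 1 ∨ d % 8 = 3 ∨ d % 8 = 5 ∨ d % 8 = 7 := by omega
        rcases h8 with h | h | h | h
        · rw [show (5 + 2 * d) % 8 = 7 by omega, h]; exact chi48_table.1
        · rw [show (5 + 2 * d) % 8 = 3 by omega, h]; exact chi48_table.2.1
        · rw [show (5 + 2 * d) % 8 = 7 by omega, h]; exact chi48_table.2.2.1
        · rw [show (5 + 2 * d) % 8 = 3 by omega, h]; exact chi48_table.2.2.2
      refine twoDescentClass_mem_selmerLocalKer_two_of_res8_mul_eq_one v hv (n_mod_four hp hp2) _ _ hva hvb ?_ ?_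
      · rw [Units.val_mk0]
        exact res8_mul_eq_one_of_eq (cast_bitProd_ne_zero hp α) h5n0
          (res8_eq_of_chi4_chi8 (cast_bitProd_ne_zero hp α) h5n0 (by rw [h4a, hd.1]) (by rw [h8a, hd.2]))
      · rw [Units.val_mk0]
        refine res8_mul_eq_one_of_eq (cast_candB_ne_zero hp β) (by norm_num)
          (res8_eq_of_chi4_chi8 (cast_candB_ne_zero hp β) (by norm_num) ?_ ?_)
        · rw [h4b, show (5 : ℚ) = ((5 : ℤ) : ℚ) by norm_num, chi4_intCast (by decide)]; decide
        · rw [h8b, show (5 : ℚ) = ((5 : ℤ) : ℚ) by norm_num, chi8_intCast' (by decide)]; decide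

end Selmer

end CongruentNumberEvenMonskySelmerKernel

end Literature.NumberTheory.EllipticCurves

end

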